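import Mathlib
import HarnessLib
import Summits.Ventures.LatticeQCDFlow.Exactness.NCMCGeneralSpaceIndicatorCLT

/-!
# Asymptotic coverage of the plug-in interval `p̂ ± z √(2 τ̄ p̂(1 − p̂)/n)`: the limit is `N(0, τ_int/τ̄)([−z, z])`, at least nominal whenever `τ̄ ≥ τ_int` — for every chain with a Doeblin power, from every initial law

HONEST FRAMING: exact (Metropolis-corrected) sampling algorithms for lattice gauge theory;
figures of merit are autocorrelation/cost numbers at stated couplings and volumes; no
continuum-physics claim.

Venture `LatticeQCDFlow` (cell pub-lqcd), topic `Exactness`; FANOUT row 13 (`eng-snf`, GEN-19).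
NEW WORK of the cell, not a published result; no definition is introduced; nothing is cited as a
fact (Slutsky and the portmanteau theorem from Mathlib).  The event-frequency CLT of
`NCMCGeneralSpaceIndicatorCLT.lean` says `√n (p̂_n − π(A)) ⇒ N(0, 2 τ_int π(A)(1 − π(A)))` with the
POPULATION integrated autocorrelation time `τ_int = Scoring.tauInt (setACF κ π A)`, which a seat does
not know.  What a seat REPORTS is `p̂_n ± z √(2 τ̄ p̂_n(1 − p̂_n)/n)` with some number `τ̄` (a windowed
estimate, or GEN-18's certified bound `1/2 + (m/ε − 1)/(1 − π(A))`).  THIS file: the standardised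
statistic `√n (p̂_n − π(A)) / √(2 τ̄ p̂_n (1 − p̂_n))` converges in distribution to `N(0, τ_int/τ̄)`
(Slutsky with the plug-in `p̂_n → π(A)` from every start), so the coverage probability of the reported
interval converges to `N(0, τ_int/τ̄)([−z, z])` (portmanteau), which is `≥ N(0,1)([−z, z])` — the
nominal level — as soon as `τ̄ ≥ τ_int` (Gaussian interval mass is monotone in the variance).  The
NCMC `dF_occ` instance is `NCMCGeneralSpaceOccupancyChainCoverage.lean`.

## Content

* `measure_Icc_gaussianReal_anti` — for `w ≤ 1` and `z ≥ 0`: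
  `gaussianReal 0 1 (Icc (−z) z) ≤ gaussianReal 0 w (Icc (−z) z)`.
* **`tendsto_measure_abs_mul_le_of_clt`** — PLUG-IN COVERAGE LEMMA: if `X_n ⇒ Y ~ N(0, w)` under `P`
  and `B_n → b` almost surely (`B_n` measurable), then for `z > 0`
  `P{|X_n B_n| ≤ z} → gaussianReal 0 (b² w) (Icc (−z) z)`.
* **`tendsto_measure_standardizedIndicator_le_of_nHit`** — for a chain with a Doeblin power, an event
  `A` with `0 < π(A) < 1`, any `τ̄ > 0`, `z > 0`, EVERY initial law:
  `P_{μ₀}{|√n (p̂_n − π(A)) · (√(2 τ̄ p̂_n (1 − p̂_n)))⁻¹| ≤ z} → gaussianReal 0 (τ_int/τ̄) (Icc (−z) z)`;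
  **`nominal_le_coverage_limit_of_le`** — that limit is `≥ gaussianReal 0 1 (Icc (−z) z)` when
  `τ_int ≤ τ̄`.

NOT CLAIMED: a typed consistent estimator `τ̂_n → τ_int` (with it the limit would be exactly nominal —
the same lemma applies verbatim to a random `τ̄_n → τ̄` but none is constructed here); finite-`n`
coverage; rates.
-/

namespace Summit.Ventures.LatticeQCDFlow.Exactness.GeneralNCMC

open MeasureTheory ProbabilityTheory Set Filter Finset
open scoped ENNReal NNReal Topology

/-! ## §1 Gaussian interval mass is monotone in the variance -/

section Gauss

/-- **Centered Gaussian interval mass decreases with the variance**: for `w ≤ 1` and `z ≥ 0`,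
`N(0,1)([−z, z]) ≤ N(0,w)([−z, z])` (`N(0,0) = δ_0`). -/
theorem measure_Icc_gaussianReal_anti {w : ℝ≥0} (hw : w ≤ 1) {z : ℝ} (hz : 0 ≤ z) :
    gaussianReal 0 1 (Icc (-z) z) ≤ gaussianReal 0 w (Icc (-z) z) := by
  by_cases hw0 : w = 0
  · rw [hw0, gaussianReal_zero_var, Measure.dirac_apply' _ measurableSet_Icc,
      Set.indicator_of_mem (by simp [hz] : (0 : ℝ) ∈ Icc (-z) z), Pi.one_apply]
    exact prob_le_one
  · set s : ℝ := Real.sqrt (w : ℝ) with hs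
    have hs0 : 0 ≤ s := Real.sqrt_nonneg _
    have hs1 : s ≤ 1 := by
      rw [hs, Real.sqrt_le_one]
      exact_mod_cast hw
    have hmap : (gaussianReal 0 1).map (s * ·) = gaussianReal 0 w := by
      rw [gaussianReal_map_const_mul, mul_zero, mul_one]
      congr 1
      apply NNReal.eq
      rw [NNReal.coe_mk, hs, Real.sq_sqrt w.coe_nonneg]
    rw [← hmap, Measure.map_apply (measurable_const_mul s) measurableSet_Icc]
    refine measure_mono fun y hy => ?_
    simp only [Set.mem_preimage, Set.mem_Icc] at hy ⊢
    constructor <;> nlinarith [hy.1, hy.2]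

end Gauss

/-! ## §2 Coverage from a CLT with a plug-in scale -/

section PlugIn

variable {Ω₀ : Type*} [MeasurableSpace Ω₀] {P : Measure Ω₀} [IsProbabilityMeasure P]
  {Ω' : Type*} [MeasurableSpace Ω'] {P' : Measure Ω'} [IsProbabilityMeasure P']

/-- **PLUG-IN COVERAGE LEMMA.**  If `X_n ⇒ Y` with `Y ~ N(0, w)`, and `B_n → b` almost surely (all
measurable), then for every `z > 0`: `P{|X_n · B_n| ≤ z} → gaussianReal 0 (b² w) (Icc (−z) z)`
(`X_n` is a.e.-measurable as part of the convergence in distribution). -/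
theorem tendsto_measure_abs_mul_le_of_clt {X B : ℕ → Ω₀ → ℝ}
    (hBm : ∀ n, Measurable (B n)) {w : ℝ≥0} {b : ℝ} {Y : Ω' → ℝ}
    (hY : HasLaw Y (gaussianReal 0 w) P')
    (hX : TendstoInDistribution X atTop Y (fun _ => P) P')
    (hB : ∀ᵐ x ∂P, Tendsto (fun n => B n x) atTop (𝓝 b)) {z : ℝ} (hz : 0 < z) :
    Tendsto (fun n => P {x | |X n x * B n x| ≤ z}) atTop
      (𝓝 (gaussianReal 0 (NNReal.mk (b ^ 2) (sq_nonneg _) * w) (Icc (-z) z))) := by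
  have hBconv : TendstoInMeasure P B atTop (fun _ => b) :=
    tendstoInMeasure_of_tendsto_ae (fun n => (hBm n).aestronglyMeasurable) hB
  have hXB := hX.continuous_comp_prodMk_of_tendstoInMeasure_const
    (g := fun p : ℝ × ℝ => p.1 * p.2) (by fun_prop) hBconv (fun n => (hBm n).aemeasurable)
  have hlaw : HasLaw (fun ω => Y ω * b) (gaussianReal 0 (NNReal.mk (b ^ 2) (sq_nonneg _) * w)) P' := by
    have h := gaussianReal_mul_const hY b
    rwa [mul_zero] at h
  have hnull : (P'.map fun ω => Y ω * b) (frontier (Icc (-z) z)) = 0 := by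
    rw [hlaw.map_eq, frontier_Icc (by linarith : -z ≤ z)]
    by_cases hv : NNReal.mk (b ^ 2) (sq_nonneg _) * w = 0
    · rw [hv, gaussianReal_zero_var, Measure.dirac_apply' _ (by measurability)]
      rw [Set.indicator_of_notMem]
      simp only [Set.mem_insert_iff, Set.mem_singleton_iff, not_or]
      constructor <;> intro h0 <;> linarith
    · haveI := nullSingletonClass_gaussianReal (μ := 0) hv
      exact (Set.toFinite {-z, z}).measure_zero _
  have key := ProbabilityMeasure.tendsto_measure_of_null_frontier_of_tendsto' hXB.tendsto
    (E := Icc (-z) z) (by simpa using hnull)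
  simp only [ProbabilityMeasure.coe_mk] at key
  rw [hlaw.map_eq] at key
  refine key.congr fun n => ?_
  rw [Measure.map_apply_of_aemeasurable (hXB.forall_aemeasurable n) measurableSet_Icc]
  congr 1
  ext x
  simp only [Set.mem_preimage, Set.mem_Icc, mem_setOf_eq, abs_le]

end PlugIn

/-! ## §3 The standardised event frequency under a Doeblin power -/

section Event

variable {S : Type*} [MeasurableSpace S]
  {κ : Kernel S S} [IsMarkovKernel κ] {π : Measure S} [IsProbabilityMeasure π]
  {ν : Measure S} [IsProbabilityMeasure ν] {ε : ℝ≥0∞} {m : ℕ}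

/-- **COVERAGE OF THE REPORTED FREQUENCY INTERVAL.**  `κ` Markov, `π` invariant,
`(nHit κ m)(z,·) ≥ ε ν` (`ε ≠ 0`, `0 < m`), `A` measurable with `0 < π(A) < 1`, `τ̄ > 0`, `z > 0`:
for EVERY initial law `μ₀`,
`P_{μ₀}{|√n (p̂_n − π(A)) · (√(2 τ̄ p̂_n(1 − p̂_n)))⁻¹| ≤ z} → gaussianReal 0 (τ_int/τ̄) (Icc (−z) z)`,
`τ_int = Scoring.tauInt (setACF κ π A)`. -/
theorem tendsto_measure_standardizedIndicator_le_of_nHit (hπ : Kernel.Invariant κ π)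
    (hε : ε ≠ 0) (hmin : ∀ z, ε • ν ≤ nHit κ m z) (hm : 0 < m)
    {A : Set S} (hA : MeasurableSet A) (h0 : 0 < π.real A) (h1 : π.real A < 1)
    (μ₀ : Measure S) [IsProbabilityMeasure μ₀] {τbar : ℝ} (hτ : 0 < τbar) {z : ℝ} (hz : 0 < z)
    [IsProbabilityMeasure (Kernel.trajMeasure (X := fun _ : ℕ => S) μ₀
        (fun n : ℕ => κ.comap (fun hh : (i : ↥(Finset.Iic n)) → S => hh ⟨n, Finset.mem_Iic.2 le_rfl⟩)
          (measurable_pi_apply _)))] :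
    Tendsto (fun n : ℕ => (Kernel.trajMeasure (X := fun _ : ℕ => S) μ₀
        (fun n : ℕ => κ.comap (fun hh : (i : ↥(Finset.Iic n)) → S => hh ⟨n, Finset.mem_Iic.2 le_rfl⟩)
          (measurable_pi_apply _)))
        {x : ℕ → S | |Real.sqrt n * ((∑ t ∈ range n, A.indicator (1 : S → ℝ) (x t)) / n - π.real A)
          * (Real.sqrt (2 * τbar * ((∑ t ∈ range n, A.indicator (1 : S → ℝ) (x t)) / n
            * (1 - (∑ t ∈ range n, A.indicator (1 : S → ℝ) (x t)) / n))))⁻¹| ≤ z})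
      atTop (𝓝 (gaussianReal 0 (Real.toNNReal (Scoring.tauInt (setACF κ π A) / τbar))
        (Icc (-z) z))) := by
  have hv0 : 0 < π.real A * (1 - π.real A) := mul_pos h0 (sub_pos.2 h1)
  have hf : Measurable (A.indicator (1 : S → ℝ)) := measurable_one.indicator hA
  -- the CLT with the canonical Gaussian variable
  have hclt := tendstoInDistribution_indicator_timeAverage_of_nHit hπ hε hmin hm hA h0 h1 μ₀
    (P' := gaussianReal 0 (Real.toNNReal (2 * Scoring.tauInt (setACF κ π A)
      * (π.real A * (1 - π.real A))))) (Y := id) HasLaw.id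
  -- the plug-in scale
  have hpm : ∀ n : ℕ, Measurable fun x : ℕ → S =>
      (∑ t ∈ range n, A.indicator (1 : S → ℝ) (x t)) / n := fun n =>
    (Finset.measurable_sum _ fun t _ => hf.comp (measurable_pi_apply t)).div_const _
  have hBm : ∀ n : ℕ, Measurable fun x : ℕ → S =>
      (Real.sqrt (2 * τbar * ((∑ t ∈ range n, A.indicator (1 : S → ℝ) (x t)) / n
        * (1 - (∑ t ∈ range n, A.indicator (1 : S → ℝ) (x t)) / n))))⁻¹ := fun n =>
    ((measurable_const.mul ((hpm n).mul (measurable_const.sub (hpm n)))).sqrt).inv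
  have hB : ∀ᵐ x ∂(Kernel.trajMeasure (X := fun _ : ℕ => S) μ₀
      (fun n : ℕ => κ.comap (fun hh : (i : ↥(Finset.Iic n)) → S => hh ⟨n, Finset.mem_Iic.2 le_rfl⟩)
        (measurable_pi_apply _))),
      Tendsto (fun n : ℕ => (Real.sqrt (2 * τbar * ((∑ t ∈ range n, A.indicator (1 : S → ℝ) (x t)) / n
        * (1 - (∑ t ∈ range n, A.indicator (1 : S → ℝ) (x t)) / n))))⁻¹) atTop
        (𝓝 ((Real.sqrt (2 * τbar * (π.real A * (1 - π.real A))))⁻¹)) := by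
    have h := tendsto_sum_div_anyLaw_of_nHit_minorised hπ hε hmin hf
      ((integrable_const (1 : ℝ)).indicator hA) μ₀
    rw [integral_indicator_one hA] at h
    filter_upwards [h] with x hx
    exact (((hx.mul (tendsto_const_nhds.sub hx)).const_mul (2 * τbar)).sqrt).inv₀
      (Real.sqrt_pos.2 (by positivity)).ne'
  have h := tendsto_measure_abs_mul_le_of_clt hBm HasLaw.id hclt hB hz
  have hnn : NNReal.mk (((Real.sqrt (2 * τbar * (π.real A * (1 - π.real A))))⁻¹) ^ 2) (sq_nonneg _)
      * (2 * Scoring.tauInt (setACF κ π A) * (π.real A * (1 - π.real A))).toNNReal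
      = (Scoring.tauInt (setACF κ π A) / τbar).toNNReal := by
    have hsq : ((Real.sqrt (2 * τbar * (π.real A * (1 - π.real A))))⁻¹) ^ 2
        = (2 * τbar * (π.real A * (1 - π.real A)))⁻¹ := by
      rw [inv_pow, Real.sq_sqrt (by positivity)]
    rw [show NNReal.mk (((Real.sqrt (2 * τbar * (π.real A * (1 - π.real A))))⁻¹) ^ 2) (sq_nonneg _)
        = ((2 * τbar * (π.real A * (1 - π.real A)))⁻¹).toNNReal by
          apply NNReal.eq; rw [NNReal.coe_mk, Real.coe_toNNReal _ (by positivity), hsq],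
      ← Real.toNNReal_mul (by positivity)]
    congr 1
    have hp0' : π.real A ≠ 0 := h0.ne'
    have hp1 : 1 - π.real A ≠ 0 := (sub_pos.2 h1).ne'
    have hτ' : τbar ≠ 0 := hτ.ne'
    field_simp
  rw [hnn] at h
  exact h

/-- **The limit coverage is at least nominal when `τ̄ ≥ τ_int`**:
`gaussianReal 0 1 (Icc (−z) z) ≤ gaussianReal 0 (τ_int/τ̄) (Icc (−z) z)`. -/
theorem nominal_le_coverage_limit_of_le {τ τbar : ℝ} (hτbar : 0 < τbar) (hle : τ ≤ τbar)
    {z : ℝ} (hz : 0 ≤ z) :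
    gaussianReal 0 1 (Icc (-z) z) ≤ gaussianReal 0 (Real.toNNReal (τ / τbar)) (Icc (-z) z) := by
  refine measure_Icc_gaussianReal_anti ?_ hz
  rw [← NNReal.coe_le_coe, NNReal.coe_one]
  rcases le_or_gt 0 (τ / τbar) with h | h
  · rw [Real.coe_toNNReal _ h]
    exact (div_le_one hτbar).2 hle
  · rw [Real.toNNReal_of_nonpos h.le, NNReal.coe_zero]
    exact zero_le_one

end Event

end Summit.Ventures.LatticeQCDFlow.Exactness.GeneralNCMC
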